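import Literature.MathematicalPhysics.QuantumFieldTheory.Balaban1983to89.B13Contraction113

/-! # `Balaban1983to89.B11Eq185SecondDerivative` — (185)–(188) of [Balaban1985Variational]: the second variational
derivative of V by the Cauchy formula, the bound (186) DERIVED from Proposition 4 with the printed radius and the
printed constant 4C₄ε₃, its composition (187) with the norm of G̃, and the Neumann-series solution (188) of (184)

statement-level skeleton of published theorems with citation tags; proofs where landed; nothing here is a claim about
the Yang–Mills mass gap.

CITATION HEADER (lean-in-tree rule 2026-08-18).  T. Bałaban, *The variational problem and background fields in
renormalization group method for lattice gauge theories*, Commun. Math. Phys. **102**, 277–309 (1985)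
[Balaban1985Variational] (cell paper B11; held `paper:balaban1985-cmp102-variational-background`, journal page = PDF
page + 276): Sect. G, pp. 307–308 [PDF 31–32], displays (184)–(188); Sect. D, pp. 292–293 [PDF 16–17], Proposition 4
with (97)–(98).  Render `b2b-balaban-ref1/pages/1985-cmp102-variational-background/1985-cmp102-variational-
background-p032-x2.png` (p. 308) READ AS AN IMAGE by this seat (unit `lit-balaban-r08`, gen 4, 2026-08-21); p. 293
from the held text layer (`p0017.txt`, (98) legible) cross-checked against the sibling module `B11Prop6Scheme`
(which quotes the p. 295 render).  NEW sibling module of the `B11*` family; imports only `B13Contraction113` (for the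
hypothesis structure `QuadAnalytic` = the shape in which Proposition 4 enters `B11Prop6Scheme`) and, through it,
Mathlib; modifies nothing.  Cell row: SKELETON `B11.Eq185` ((185)–(188), p. 308), whose status before this module was
«typed ((188) as hypothesis `B11SectG.Bound188`) + proved (Cauchy/Neumann steps over abstract spaces / block
majorants)»; what is added here is the printed DERIVATION of (186) from Proposition 4 with its constant, and (185),
(187), (188) at the level of vectors and bounded operators.

WHAT IS PRINTED.  p. 307 [PDF 31], last sentence: *«For a configuration A′ satisfying (77) with ε₃ sufficiently
small we have»* — p. 308 [PDF 32] (render read as image):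
*«((δ²/δA′²)V)(A′)𝔄 = (d/dτ)((δ/δA′)V)(A′ + τ𝔄)|_{τ=0} = (1/2πi) ∮_{|τ|=r} (dτ/τ²) ((δ/δA′)V)(A′ + τ𝔄)  (185)
and taking  r = max{|A′|_{(−1)}, |∇A′|_{(−2)}} (max{|𝔄|_{(−1)}, |∇𝔄|_{(−2)}})⁻¹,  we get from Proposition 4
|((δ²/δA′²)V)(A′)𝔄|_{(−3)} ≤ 4C₄ε₃ max{|𝔄|_{(−1)}, |∇𝔄|_{(−2)}}.  (186)
This implies the bound  |G̃((δ²/δA′²)V)(𝒜₀ + H₀B)𝔄|_{(−1)}, |∇G̃((δ²/δA′²)V)(𝒜₀ + H₀B)𝔄|_{(−2)}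
≤ O(1)B₀C₄B₅ε₁ max{|𝔄|_{(−1)}, |∇𝔄|_{(−2)}}  (187)  for ε₁ sufficiently small, hence the norm of the linear
operator is small also. Thus Eq. (184) can be solved by the Neumann series expansion
𝔄₀ = (I + G̃((δ²/δA′²)V)(𝒜₀ + H₀B))⁻¹ (G̃Δ^{(2)}H₀ − G̃((δ²/δA′²)V)(𝒜₀ + H₀B)H₀)  (188)»*.
p. 292–293 [PDF 16–17], Proposition 4: *«Let us consider the functional V(A′) on the space of configurations A′ with
values in the complexified Lie algebra 𝔤ᶜ, and satisfying the inequalities (77), i.e. max{|A′|_{(−1)}, |∇A′|_{(−2)}}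
< ε₃ for ε₃ ≦ a₃, where a₃ is a sufficiently small positive constant. The functional derivative of V(A′) is an
analytic function on this space, and satisfies the estimate … (97) … The above estimate can be formulated also in the
following way: |(δ/δA′)V(A′)|_{(−3)} ≤ C₄(max{|A′|_{(−1)}, |∇A′|_{(−2)}})², (98) and it is valid if max{|A′|_{(−1)},
|∇A′|_{(−2)}} ≤ a₃»*.  p. 307 [PDF 31], (184): *«(I + G̃((δ²/δA′²)V)(𝒜₀ + H₀B))𝔄₀ = G̃Δ^{(2)}H₀ −
G̃((δ²/δA′²)V)(𝒜₀ + H₀B)H₀, (184) where the derivative (δ²/δA′²)V is treated as a kernel of a linear operator.»*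

WHAT IS PROVED HERE (kernel-checked, complete proofs; abstract complex normed spaces 𝒴 ∋ A′, 𝔄 with ONE norm
standing for max{|·|_{(−1)}, |∇·|_{(−2)}} and 𝒵 with one norm standing for |·|_{(−3)}, exactly the modelling
convention D-B11-20 of `B11Prop6Scheme`; W : 𝒴 → 𝒵 stands for A′ ↦ ((δ/δA′)V)(A′)).
 §1 `lineMap`, `secondDeriv` — the objects of (185): τ ↦ W(A′ + τ𝔄) and ((δ²/δA′²)V)(A′)𝔄 := its τ-derivative at 0
    (the paper's first equality in (185) is the definition used here); `secondDeriv_eq_fderiv` — (185), first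
    equality, against the Fréchet derivative when W is Fréchet-differentiable at A′ (chain rule);
    `secondDeriv_eq_circleIntegral` — (185), second equality, the Cauchy formula on |τ| = r (Mathlib's
    `DiffContOnCl.deriv_eq_smul_circleIntegral`; needs 𝒵 complete, automatic on the finite lattice).
 §2 `norm_secondDeriv_le_of_radius` — the Cauchy estimate behind (186) for an arbitrary admissible radius ρ:
    ‖((δ²/δA′²)V)(A′)𝔄‖ ≤ C₄(‖A′‖ + ρ‖𝔄‖)²/ρ whenever ‖A′‖ + ρ‖𝔄‖ < a₃, from `QuadAnalytic W C₄ a₃` ((98) on the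
    open ball + analyticity along complex lines); `norm_secondDeriv_le` — with THE PRINTED radius
    r = ‖A′‖·‖𝔄‖⁻¹ (so that the argument on the circle has size ≤ 2‖A′‖, and (98) gives C₄(2‖A′‖)² = 4C₄‖A′‖²):
    ‖((δ²/δA′²)V)(A′)𝔄‖ ≤ 4C₄‖A′‖‖𝔄‖ for 2‖A′‖ < a₃ — including the degenerate cases 𝔄 = 0 (constant line) and
    A′ = 0 (radius → 0), where the printed r is not defined but the bound holds; `ineq186` — **(186) as printed**:
    under (77) ‖A′‖ ≤ ε₃ and the located smallness 2ε₃ < a₃ («ε₃ sufficiently small», p. 307, = the condition under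
    which Proposition 4 applies on the circle), ‖((δ²/δA′²)V)(A′)𝔄‖ ≤ 4C₄ε₃‖𝔄‖.
 §3 `ineq187` — **(187)** with the O(1) explicit: if ‖G̃f‖ ≤ κB₀‖f‖ (the norm |·|_{(−3)} → max{|·|_{(−1)},
    |∇·|_{(−2)}} of G̃, by reference to [5]) and A′ = 𝒜₀ + H₀B satisfies (77) with ε₃ ≤ κ′B₅ε₁, 2ε₃ < a₃, then
    ‖G̃((δ²/δA′²)V)(A′)𝔄‖ ≤ (4κκ′)·B₀C₄B₅ε₁·‖𝔄‖; `secondDeriv_add`/`secondDeriv_smul` — 𝔄 ↦ ((δ²/δA′²)V)(A′)𝔄 is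
    ℂ-linear when W is Fréchet-differentiable at A′ («the linear operator»); `opNorm_le_of_187` — «hence the norm of
    the linear operator is small also»: any continuous linear T with ‖T𝔄‖ ≤ θ‖𝔄‖, 0 ≤ θ, has ‖T‖ ≤ θ.
 §4 `eq188_solution`, `eq188_unique`, `eq188_neumann_series` — **(188)**: for a continuous linear T on a complete 𝒴
    with ‖T‖ < 1 (from (187) for ε₁ sufficiently small), I + T is invertible, (I + T)⁻¹y = Σₙ (−T)ⁿ y is THE solution
    of 𝔄₀ + T𝔄₀ = y (Mathlib `Units.oneSub`), i.e. (184) is solved by the Neumann series; `existsUnique_184_of_187` —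
    from the (187)-shape bound ‖T𝔄‖ ≤ θ‖𝔄‖ with θ < 1, (184) has exactly one solution.

NOT CERTIFIED HERE (hypotheses, by name).  Proposition 4 itself ((97)/(98) and the analyticity of (δ/δA′)V for
complex arguments — `B11.Prop4Printed` at statement level; here the hypothesis structure `QuadAnalytic W C₄ a₃`);
the norm bound of G̃ (Theorem 3.3/3.13 of [5] = `Balaban1985BackgroundPropagators`, cell rows B9.Thm3.3/Thm3.13);
the size ε₃ = O(1)B₅ε₁ of 𝒜₀ + H₀B in (77) ((173)–(174), (179)); the identification of the kernel-level operator
«(δ²/δA′²)V treated as a kernel» with the directional derivative (on the finite lattice every linear map is a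
kernel); the decay content of (188)–(190) (done over block majorants in `B11SectG`, `B11TildeG190`).
MODELLING CONVENTIONS: as in `B11Prop6Scheme` (D-B11-20): (98) is used with strict size < a₃ (every argument here has
size ≤ ‖A′‖ + ρ‖𝔄‖ < a₃); «analytic» along complex lines = `DifferentiableOn ℂ` on {τ | ‖A′ + τ𝔄‖ < a₃}.
value = kernel bookkeeping of four printed lines of Sect. G, NOT summit progress.
(v1.1 DOCFIX, r08 gen 28, QUOTE-AUDIT-B11 T1: the Proposition 4 quotation above read «for ε₃ = a₃» — print p. 292 has
«for ε₃ ≦ a₃» (page image checked); glyph restored. Declarations and proofs byte-identical.)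
-/

open Metric Set Filter Topology Complex

namespace Literature.MathematicalPhysics.QuantumFieldTheory.Balaban1983to89.B11Eq185SecondDerivative

open Literature.MathematicalPhysics.QuantumFieldTheory.Balaban1983to89.B13Contraction113 (QuadAnalytic)

section deriv185

variable {𝒴 𝒵 : Type*} [NormedAddCommGroup 𝒴] [NormedSpace ℂ 𝒴] [NormedAddCommGroup 𝒵] [NormedSpace ℂ 𝒵]

/-! ## §1 The objects of (185) -/

/-- The complex line of (185): τ ↦ ((δ/δA′)V)(A′ + τ𝔄), for W = (δ/δA′)V.
[cite: Balaban1985Variational, (185) p.308] -/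
def lineMap (W : 𝒴 → 𝒵) (A' 𝔄 : 𝒴) : ℂ → 𝒵 := fun τ => W (A' + τ • 𝔄)

/-- (185), first member/first equality taken as the definition: ((δ²/δA′²)V)(A′)𝔄 := (d/dτ)((δ/δA′)V)(A′ + τ𝔄)|_{τ=0}.
[cite: Balaban1985Variational, (185) p.308] -/
noncomputable def secondDeriv (W : 𝒴 → 𝒵) (A' 𝔄 : 𝒴) : 𝒵 := deriv (lineMap W A' 𝔄) 0

omit [NormedAddCommGroup 𝒵] [NormedSpace ℂ 𝒵] in
/-- Unfolding of the complex line of (185). [cite: Balaban1985Variational, (185) p.308] -/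
@[simp] theorem lineMap_apply (W : 𝒴 → 𝒵) (A' 𝔄 : 𝒴) (τ : ℂ) : lineMap W A' 𝔄 τ = W (A' + τ • 𝔄) := rfl

/-- The line τ ↦ A′ + τ𝔄 of (185) has τ-derivative 𝔄 everywhere (the step behind the first equality of (185)).
[cite: Balaban1985Variational, (185) p.308] -/
theorem hasDerivAt_line (A' 𝔄 : 𝒴) (τ : ℂ) : HasDerivAt (fun τ : ℂ => A' + τ • 𝔄) 𝔄 τ := by
  simpa using ((hasDerivAt_id τ).smul_const 𝔄).const_add A'

/-- **(185), first equality** against the Fréchet derivative: if W = (δ/δA′)V is (Fréchet-)differentiable at A′, then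
(d/dτ)W(A′ + τ𝔄)|_{τ=0} = (DW)(A′)𝔄 — the chain rule. [cite: Balaban1985Variational, (185) p.308] -/
theorem secondDeriv_eq_fderiv {W : 𝒴 → 𝒵} {A' : 𝒴} (hW : DifferentiableAt ℂ W A') (𝔄 : 𝒴) :
    secondDeriv W A' 𝔄 = fderiv ℂ W A' 𝔄 := by
  have h0 : A' + (0 : ℂ) • 𝔄 = A' := by simp
  have hW' : DifferentiableAt ℂ W (A' + (0 : ℂ) • 𝔄) := by rwa [h0]
  have h := hW'.hasFDerivAt.comp_hasDerivAt (0 : ℂ) (hasDerivAt_line A' 𝔄 0)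
  rw [h0] at h
  exact h.deriv

/-- 𝔄 ↦ ((δ²/δA′²)V)(A′)𝔄 is additive («the linear operator» of p. 308) when W is differentiable at A′.
[cite: Balaban1985Variational, (184)–(187) pp.307–308] -/
theorem secondDeriv_add {W : 𝒴 → 𝒵} {A' : 𝒴} (hW : DifferentiableAt ℂ W A') (𝔄₁ 𝔄₂ : 𝒴) :
    secondDeriv W A' (𝔄₁ + 𝔄₂) = secondDeriv W A' 𝔄₁ + secondDeriv W A' 𝔄₂ := by
  simp [secondDeriv_eq_fderiv hW, map_add]

/-- 𝔄 ↦ ((δ²/δA′²)V)(A′)𝔄 is ℂ-homogeneous when W is differentiable at A′.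
[cite: Balaban1985Variational, (184)–(187) pp.307–308] -/
theorem secondDeriv_smul {W : 𝒴 → 𝒵} {A' : 𝒴} (hW : DifferentiableAt ℂ W A') (c : ℂ) (𝔄 : 𝒴) :
    secondDeriv W A' (c • 𝔄) = c • secondDeriv W A' 𝔄 := by
  simp [secondDeriv_eq_fderiv hW, map_smul]

/-- **(185), second equality**: the Cauchy formula for the τ-derivative at 0 on the circle |τ| = r,
(d/dτ)W(A′ + τ𝔄)|_{τ=0} = (1/2πi)∮_{|τ|=r} dτ τ⁻² W(A′ + τ𝔄), for a line map complex-differentiable on the open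
disc and continuous on the closed disc (𝒵 complete — automatic for the finite lattice).
[cite: Balaban1985Variational, (185) p.308] -/
theorem secondDeriv_eq_circleIntegral [CompleteSpace 𝒵] {W : 𝒴 → 𝒵} {A' 𝔄 : 𝒴} {r : ℝ} (hr : 0 < r)
    (hd : DiffContOnCl ℂ (lineMap W A' 𝔄) (ball (0 : ℂ) r)) :
    secondDeriv W A' 𝔄 = (2 * (Real.pi : ℂ) * I)⁻¹ • ∮ τ in C(0, r), (1 / τ ^ 2) • W (A' + τ • 𝔄) := by
  have h := hd.deriv_eq_smul_circleIntegral hr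
  simp only [sub_zero, lineMap_apply] at h
  rw [secondDeriv, ← inv_smul_smul₀ two_pi_I_ne_zero (deriv (lineMap W A' 𝔄) 0), ← h]

/-! ## §2 (186) from Proposition 4 -/

/-- The set of admissible τ on the complex line of (185), {τ | ‖A′ + τ𝔄‖ < a₃} (the arguments at which Proposition 4
applies), is open. [cite: Balaban1985Variational, (185) p.308; Proposition 4 p.292] -/
theorem isOpen_lineDomain (A' 𝔄 : 𝒴) (a₃ : ℝ) : IsOpen {τ : ℂ | ‖A' + τ • 𝔄‖ < a₃} :=
  isOpen_lt ((continuous_const.add (continuous_id.smul continuous_const)).norm) continuous_const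

/-- Size of the argument on the circle |τ| = ρ of (185): ‖A′ + τ𝔄‖ ≤ ‖A′‖ + ρ‖𝔄‖ for ‖τ‖ ≤ ρ (with the printed
radius this is 2·max{|A′|_{(−1)}, |∇A′|_{(−2)}}, cf. the same step in (120) p.295).
[cite: Balaban1985Variational, (185)–(186) p.308; (120) p.295] -/
theorem norm_line_le {A' 𝔄 : 𝒴} {ρ : ℝ} {τ : ℂ} (hτ : ‖τ‖ ≤ ρ) : ‖A' + τ • 𝔄‖ ≤ ‖A'‖ + ρ * ‖𝔄‖ :=
  (norm_add_le _ _).trans (by rw [norm_smul]; gcongr)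

/-- The Cauchy estimate behind (186) for an ARBITRARY admissible radius ρ > 0: if (98) holds on the open ball of
radius a₃ together with analyticity along complex lines (`QuadAnalytic W C₄ a₃`), and ‖A′‖ + ρ‖𝔄‖ < a₃, then on the
circle |τ| = ρ the argument A′ + τ𝔄 has size ≤ ‖A′‖ + ρ‖𝔄‖ < a₃, Proposition 4 gives ‖W(A′ + τ𝔄)‖ ≤ C₄(‖A′‖ +
ρ‖𝔄‖)², and Cauchy's estimate gives ‖(d/dτ)W(A′ + τ𝔄)|₀‖ ≤ C₄(‖A′‖ + ρ‖𝔄‖)²/ρ.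
[cite: Balaban1985Variational, (185)–(186) p.308; (98) p.293] -/
theorem norm_secondDeriv_le_of_radius {W : 𝒴 → 𝒵} {C₄ a₃ : ℝ} (hW : QuadAnalytic W C₄ a₃) (hC₄ : 0 ≤ C₄)
    {A' 𝔄 : 𝒴} {ρ : ℝ} (hρ : 0 < ρ) (hadm : ‖A'‖ + ρ * ‖𝔄‖ < a₃) :
    ‖secondDeriv W A' 𝔄‖ ≤ C₄ * (‖A'‖ + ρ * ‖𝔄‖) ^ 2 / ρ := by
  have hsub : closedBall (0 : ℂ) ρ ⊆ {τ : ℂ | ‖A' + τ • 𝔄‖ < a₃} := by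
    intro τ hτ
    rw [mem_closedBall, dist_zero_right] at hτ
    exact lt_of_le_of_lt (norm_line_le hτ) hadm
  have hdc : DiffContOnCl ℂ (lineMap W A' 𝔄) (ball (0 : ℂ) ρ) :=
    (hW.lineAnalytic A' 𝔄).diffContOnCl_ball hsub
  have hM : ∀ τ ∈ sphere (0 : ℂ) ρ, ‖lineMap W A' 𝔄 τ‖ ≤ C₄ * (‖A'‖ + ρ * ‖𝔄‖) ^ 2 := by
    intro τ hτ
    rw [mem_sphere, dist_zero_right] at hτ
    have hle : ‖A' + τ • 𝔄‖ ≤ ‖A'‖ + ρ * ‖𝔄‖ := norm_line_le hτ.le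
    calc ‖lineMap W A' 𝔄 τ‖ = ‖W (A' + τ • 𝔄)‖ := rfl
      _ ≤ C₄ * ‖A' + τ • 𝔄‖ ^ 2 := hW.quad _ (lt_of_le_of_lt hle hadm)
      _ ≤ C₄ * (‖A'‖ + ρ * ‖𝔄‖) ^ 2 := by gcongr
  exact Complex.norm_deriv_le_of_forall_mem_sphere_norm_le hρ hdc hM

/-- **(186) with the printed radius.**  Under `QuadAnalytic W C₄ a₃` and 2‖A′‖ < a₃ («in order to be able to apply
Proposition 4» on the circle, cf. p. 295 before (121)):  ‖((δ²/δA′²)V)(A′)𝔄‖ ≤ 4C₄‖A′‖‖𝔄‖.  For 𝔄 ≠ 0, A′ ≠ 0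
this is `norm_secondDeriv_le_of_radius` at the printed r = ‖A′‖‖𝔄‖⁻¹ (argument size ≤ 2‖A′‖, bound
C₄(2‖A′‖)²/r = 4C₄‖A′‖‖𝔄‖); for 𝔄 = 0 the line is constant; for A′ = 0 the radius is sent to 0.
[cite: Balaban1985Variational, (185)–(186) p.308; (98) p.293] -/
theorem norm_secondDeriv_le {W : 𝒴 → 𝒵} {C₄ a₃ : ℝ} (hW : QuadAnalytic W C₄ a₃) (hC₄ : 0 ≤ C₄)
    {A' : 𝒴} (hA' : 2 * ‖A'‖ < a₃) (𝔄 : 𝒴) :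
    ‖secondDeriv W A' 𝔄‖ ≤ 4 * C₄ * ‖A'‖ * ‖𝔄‖ := by
  by_cases h𝔄 : 𝔄 = 0
  · subst h𝔄
    have hconst : lineMap W A' (0 : 𝒴) = fun _ : ℂ => W A' := by
      funext τ; simp [lineMap]
    have : secondDeriv W A' (0 : 𝒴) = 0 := by
      rw [secondDeriv, hconst]; exact deriv_const (0 : ℂ) (W A')
    simp [this]
  have h𝔄pos : 0 < ‖𝔄‖ := norm_pos_iff.mpr h𝔄
  by_cases hA0 : A' = 0
  · -- degenerate case A′ = 0: the bound is 0; Cauchy on circles of radius ρ → 0 gives ‖·‖ ≤ C₄ρ‖𝔄‖² for all small ρ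
    subst hA0
    simp only [norm_zero, mul_zero, zero_mul]
    have ha₃ : 0 < a₃ := by simpa using hA'
    refine le_of_forall_pos_le_add fun δ hδ => ?_
    -- choose ρ with ρ‖𝔄‖ < a₃ and C₄ρ‖𝔄‖² ≤ δ
    set ρ : ℝ := min (a₃ / (2 * ‖𝔄‖)) (δ / (C₄ * ‖𝔄‖ ^ 2 + 1)) with hρdef
    have hden : 0 < C₄ * ‖𝔄‖ ^ 2 + 1 := by positivity
    have hρpos : 0 < ρ := lt_min (by positivity) (by positivity)
    have hρ1 : ρ * ‖𝔄‖ < a₃ := by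
      have : ρ ≤ a₃ / (2 * ‖𝔄‖) := min_le_left _ _
      calc ρ * ‖𝔄‖ ≤ a₃ / (2 * ‖𝔄‖) * ‖𝔄‖ := by gcongr
        _ = a₃ / 2 := by field_simp
        _ < a₃ := by linarith
    have hρ2 : C₄ * ‖𝔄‖ ^ 2 * ρ ≤ δ := by
      have : ρ ≤ δ / (C₄ * ‖𝔄‖ ^ 2 + 1) := min_le_right _ _
      calc C₄ * ‖𝔄‖ ^ 2 * ρ ≤ C₄ * ‖𝔄‖ ^ 2 * (δ / (C₄ * ‖𝔄‖ ^ 2 + 1)) := by gcongr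
        _ = δ * (C₄ * ‖𝔄‖ ^ 2 / (C₄ * ‖𝔄‖ ^ 2 + 1)) := by ring
        _ ≤ δ * 1 := by
            gcongr
            rw [div_le_one hden]; linarith
        _ = δ := mul_one δ
    have hb := norm_secondDeriv_le_of_radius hW hC₄ hρpos (A' := (0 : 𝒴)) (𝔄 := 𝔄)
      (by simpa using hρ1)
    calc ‖secondDeriv W 0 𝔄‖ ≤ C₄ * (‖(0 : 𝒴)‖ + ρ * ‖𝔄‖) ^ 2 / ρ := hb
      _ = C₄ * ‖𝔄‖ ^ 2 * ρ := by
          simp only [norm_zero, zero_add]; field_simp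
      _ ≤ δ := hρ2
      _ = 0 + δ := (zero_add δ).symm
  · -- generic case: the printed radius r = ‖A′‖/‖𝔄‖
    have hA'pos : 0 < ‖A'‖ := norm_pos_iff.mpr hA0
    set r : ℝ := ‖A'‖ / ‖𝔄‖ with hrdef
    have hrpos : 0 < r := div_pos hA'pos h𝔄pos
    have hr𝔄 : r * ‖𝔄‖ = ‖A'‖ := by rw [hrdef]; field_simp
    have hadm : ‖A'‖ + r * ‖𝔄‖ < a₃ := by rw [hr𝔄]; linarith
    have hb := norm_secondDeriv_le_of_radius hW hC₄ hrpos hadm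
    calc ‖secondDeriv W A' 𝔄‖ ≤ C₄ * (‖A'‖ + r * ‖𝔄‖) ^ 2 / r := hb
      _ = 4 * C₄ * ‖A'‖ * ‖𝔄‖ := by
          rw [hr𝔄, hrdef]
          field_simp
          ring

/-- **(186) as printed.**  For A′ satisfying (77), ‖A′‖ ≤ ε₃ (one norm for max{|A′|_{(−1)}, |∇A′|_{(−2)}}), with
«ε₃ sufficiently small» LOCATED as 2ε₃ < a₃ (Proposition 4 applicable at every point of the circle of the printed
radius), and (δ/δA′)V of the shape of Proposition 4 (`QuadAnalytic W C₄ a₃`: (98) + analyticity):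
‖((δ²/δA′²)V)(A′)𝔄‖_{(−3)} ≤ 4C₄ε₃‖𝔄‖.  [cite: Balaban1985Variational, (186) p.308; Proposition 4 (98) p.293; (77) p.290] -/
theorem ineq186 {W : 𝒴 → 𝒵} {C₄ a₃ ε₃ : ℝ} (hW : QuadAnalytic W C₄ a₃) (hC₄ : 0 ≤ C₄)
    {A' : 𝒴} (h77 : ‖A'‖ ≤ ε₃) (hε₃ : 2 * ε₃ < a₃) (𝔄 : 𝒴) :
    ‖secondDeriv W A' 𝔄‖ ≤ 4 * C₄ * ε₃ * ‖𝔄‖ := by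
  have hA' : 2 * ‖A'‖ < a₃ := by linarith [norm_nonneg A']
  calc ‖secondDeriv W A' 𝔄‖ ≤ 4 * C₄ * ‖A'‖ * ‖𝔄‖ := norm_secondDeriv_le hW hC₄ hA' 𝔄
    _ ≤ 4 * C₄ * ε₃ * ‖𝔄‖ := by gcongr

/-! ## §3 (187): composition with the norm of G̃, and «the norm of the linear operator is small» -/

/-- **(187)** with the O(1) explicit.  If G̃ : 𝒵 → 𝒴 is bounded from |·|_{(−3)} to max{|·|_{(−1)}, |∇·|_{(−2)}} with
constant κB₀ (by reference to [5]), the argument A′ = 𝒜₀ + H₀B satisfies (77) with ε₃ ≤ κ′B₅ε₁ and 2ε₃ < a₃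
(«for ε₁ sufficiently small»), then ‖G̃((δ²/δA′²)V)(A′)𝔄‖ ≤ (4κκ′)B₀C₄B₅ε₁‖𝔄‖ — the printed O(1)B₀C₄B₅ε₁ max{|𝔄|_{(−1)},
|∇𝔄|_{(−2)}} with O(1) = 4κκ′.  [cite: Balaban1985Variational, (187) p.308] -/
theorem ineq187 {W : 𝒴 → 𝒵} {C₄ a₃ ε₃ : ℝ} (hW : QuadAnalytic W C₄ a₃) (hC₄ : 0 ≤ C₄)
    {Gt : 𝒵 → 𝒴} {κ κ' B₀ B₅ ε₁ : ℝ} (hκB₀ : 0 ≤ κ * B₀) (hGt : ∀ f : 𝒵, ‖Gt f‖ ≤ κ * B₀ * ‖f‖)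
    {A' : 𝒴} (h77 : ‖A'‖ ≤ ε₃) (hε₃B₅ : ε₃ ≤ κ' * B₅ * ε₁) (hε₃ : 2 * ε₃ < a₃) (𝔄 : 𝒴) :
    ‖Gt (secondDeriv W A' 𝔄)‖ ≤ 4 * κ * κ' * (B₀ * C₄ * B₅ * ε₁) * ‖𝔄‖ := by
  have h186 := ineq186 hW hC₄ h77 hε₃ 𝔄
  have hε₃nn : 0 ≤ ε₃ := (norm_nonneg A').trans h77
  calc ‖Gt (secondDeriv W A' 𝔄)‖ ≤ κ * B₀ * ‖secondDeriv W A' 𝔄‖ := hGt _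
    _ ≤ κ * B₀ * (4 * C₄ * ε₃ * ‖𝔄‖) := by gcongr
    _ ≤ κ * B₀ * (4 * C₄ * (κ' * B₅ * ε₁) * ‖𝔄‖) := by gcongr
    _ = 4 * κ * κ' * (B₀ * C₄ * B₅ * ε₁) * ‖𝔄‖ := by ring

/-- «hence the norm of the linear operator is small also» (p. 308): a continuous linear operator T (here
𝔄 ↦ G̃((δ²/δA′²)V)(𝒜₀ + H₀B)𝔄) with ‖T𝔄‖ ≤ θ‖𝔄‖ for all 𝔄, θ ≥ 0 (θ = O(1)B₀C₄B₅ε₁ from (187)), has operator norm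
≤ θ.  [cite: Balaban1985Variational, (187) p.308] -/
theorem opNorm_le_of_187 (T : 𝒴 →L[ℂ] 𝒴) {θ : ℝ} (hθ : 0 ≤ θ) (hT : ∀ 𝔄 : 𝒴, ‖T 𝔄‖ ≤ θ * ‖𝔄‖) : ‖T‖ ≤ θ :=
  T.opNorm_le_bound hθ hT

end deriv185

/-! ## §4 (188): the Neumann series solves (184) -/

section neumann188

variable {𝒴 : Type*} [NormedAddCommGroup 𝒴] [NormedSpace ℂ 𝒴] [CompleteSpace 𝒴]

/-- For ‖T‖ < 1 the operator I + T is a unit of the Banach algebra of bounded operators, with inverse the Neumann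
series Σₙ (−T)ⁿ (Mathlib `Units.oneSub` at −T). [cite: Balaban1985Variational, (188) p.308] -/
noncomputable def onePlusUnit (T : 𝒴 →L[ℂ] 𝒴) (hT : ‖T‖ < 1) : (𝒴 →L[ℂ] 𝒴)ˣ :=
  Units.oneSub (-T) (by rwa [norm_neg])

/-- The unit `onePlusUnit T` is I + T (the operator inverted in (188)). [cite: Balaban1985Variational, (188) p.308] -/
@[simp] theorem onePlusUnit_val (T : 𝒴 →L[ℂ] 𝒴) (hT : ‖T‖ < 1) :
    ((onePlusUnit T hT : (𝒴 →L[ℂ] 𝒴)ˣ) : 𝒴 →L[ℂ] 𝒴) = 1 + T := by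
  simp [onePlusUnit, Units.oneSub, sub_neg_eq_add]

/-- The inverse of I + T is the Neumann series Σₙ (−T)ⁿ. [cite: Balaban1985Variational, (188) p.308] -/
theorem onePlusUnit_inv (T : 𝒴 →L[ℂ] 𝒴) (hT : ‖T‖ < 1) :
    ((onePlusUnit T hT)⁻¹ : (𝒴 →L[ℂ] 𝒴)ˣ).val = ∑' n : ℕ, (-T) ^ n := by
  simp [onePlusUnit, Units.oneSub]

/-- **(188)**: with T = G̃((δ²/δA′²)V)(𝒜₀ + H₀B) of operator norm < 1 ((187) for ε₁ sufficiently small) and right-hand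
side y = G̃Δ^{(2)}H₀ − G̃((δ²/δA′²)V)(𝒜₀ + H₀B)H₀ of (184), the vector 𝔄₀ := (I + T)⁻¹y = Σₙ(−T)ⁿ y solves (184):
𝔄₀ + T𝔄₀ = y.  [cite: Balaban1985Variational, (184) p.307, (188) p.308] -/
theorem eq188_solution (T : 𝒴 →L[ℂ] 𝒴) (hT : ‖T‖ < 1) (y : 𝒴) :
    let 𝔄₀ : 𝒴 := ((onePlusUnit T hT)⁻¹ : (𝒴 →L[ℂ] 𝒴)ˣ).val y
    𝔄₀ + T 𝔄₀ = y := by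
  intro 𝔄₀
  have hmul : ((onePlusUnit T hT : (𝒴 →L[ℂ] 𝒴)ˣ) : 𝒴 →L[ℂ] 𝒴) * ((onePlusUnit T hT)⁻¹ : (𝒴 →L[ℂ] 𝒴)ˣ).val = 1 :=
    Units.mul_inv _
  rw [onePlusUnit_val] at hmul
  have h := congrArg (fun S : 𝒴 →L[ℂ] 𝒴 => S y) hmul
  -- ((1 + T) * U⁻¹) y = 1 y, definitionally 𝔄₀ + T 𝔄₀ = y
  exact h

/-- **(188)**, uniqueness: the solution of (184) is unique (I + T is injective), so (188) is THE solution 𝔄₀.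
[cite: Balaban1985Variational, (184) p.307, (188) p.308] -/
theorem eq188_unique (T : 𝒴 →L[ℂ] 𝒴) (hT : ‖T‖ < 1) {y x₁ x₂ : 𝒴} (h₁ : x₁ + T x₁ = y) (h₂ : x₂ + T x₂ = y) :
    x₁ = x₂ := by
  have hmul : ((onePlusUnit T hT)⁻¹ : (𝒴 →L[ℂ] 𝒴)ˣ).val * ((onePlusUnit T hT : (𝒴 →L[ℂ] 𝒴)ˣ) : 𝒴 →L[ℂ] 𝒴) = 1 :=
    Units.inv_mul _
  rw [onePlusUnit_val] at hmul
  have key : ∀ x : 𝒴, ((onePlusUnit T hT)⁻¹ : (𝒴 →L[ℂ] 𝒴)ˣ).val (x + T x) = x := by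
    intro x
    -- (U⁻¹ * (1 + T)) x = 1 x, definitionally U⁻¹ (x + T x) = x
    exact congrArg (fun S : 𝒴 →L[ℂ] 𝒴 => S x) hmul
  rw [← key x₁, ← key x₂, h₁, h₂]

/-- **(188)**, the series: the solution is the Neumann series Σₙ (−T)ⁿ y evaluated at y (the operator series
converges in operator norm since ‖T‖ < 1). [cite: Balaban1985Variational, (188) p.308] -/
theorem eq188_neumann_series (T : 𝒴 →L[ℂ] 𝒴) (hT : ‖T‖ < 1) (y : 𝒴) :
    ((onePlusUnit T hT)⁻¹ : (𝒴 →L[ℂ] 𝒴)ˣ).val y = (∑' n : ℕ, (-T) ^ n) y := by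
  rw [onePlusUnit_inv]

/-- The smallness that makes (188) available, LOCATED: if the bound (187) reads ‖T𝔄‖ ≤ θ‖𝔄‖ with
θ = O(1)B₀C₄B₅ε₁ < 1 («for ε₁ sufficiently small»), then ‖T‖ < 1 and (184) has exactly one solution, given by (188).
[cite: Balaban1985Variational, (187)–(188) p.308] -/
theorem existsUnique_184_of_187 (T : 𝒴 →L[ℂ] 𝒴) {θ : ℝ} (hθ : 0 ≤ θ) (hθ1 : θ < 1)
    (hT : ∀ 𝔄 : 𝒴, ‖T 𝔄‖ ≤ θ * ‖𝔄‖) (y : 𝒴) : ∃! 𝔄₀ : 𝒴, 𝔄₀ + T 𝔄₀ = y := by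
  have hn : ‖T‖ < 1 := lt_of_le_of_lt (T.opNorm_le_bound hθ hT) hθ1
  exact ⟨_, eq188_solution T hn y, fun x hx => eq188_unique T hn hx (eq188_solution T hn y)⟩

end neumann188

end Literature.MathematicalPhysics.QuantumFieldTheory.Balaban1983to89.B11Eq185SecondDerivative
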